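import Summits.MatrixMultiplication.MatrixMultiplication.Theses.EPRFaces
import Literature.Computability.AlgebraicComplexity.RectangularExponentAsymptoticRank
import Literature.Computability.AlgebraicComplexity.AsymptoticSpectrumDuality
import Literature.Computability.AlgebraicComplexity.DegenerationSpectralMonotone
import Literature.Barriers.MatrixMultiplication.RectangularBarrier

/-!
# Route EPRFaces — support `SpectralFaceForm` (item `stmt-MatrixMultiplication-10900`)

The chart dictionary for the face-maximiser statement B of route `EPRFaces`, B in rank form:

  (∃ universal spectral point `F` over `ℂ` with `F(⟨2,2,2⟩) = 2^ω` and `F(⟨1,1,2⟩) = 2`)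
    ↔ (∀ k ≥ 1, ∀ β, R(⟨n,n,n^k⟩) = O(n^β) → ω + (k − 1) ≤ β).

Proof (all ingredients are proved in the tree):

* rank form ↔ `ω + (k − 1) ≤ ω(1,1,k)` with `ω(1,1,k) = omegaRect ℂ 1 1 k` (`⌈n^1⌉ = n`,
  `⌈n^k⌉ = n^k`; the admissible exponents of `(1,1,k)` are nonempty and bounded below);
* (→) multiplicativity of universal spectral points on matrix multiplication tensors
  (`IsUniversalSpectralPoint.isAdequate`, CLLZ footnote 3) gives
  `F(⟨2,2,2^(j+1)⟩) = F(⟨2,2,2⟩) · F(⟨1,1,2⟩)^j = 2^(ω+j)`, and Strassen duality with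
  `R̃(⟨2,2,2^k⟩) = 2^{ω(1,1,k)}` (`asymptoticRank_matMulTensor_rect`) gives `ω + j ≤ ω(1,1,j+1)`;
* (←) the duality maximiser `F` at `⟨2,2,4⟩` has `F(⟨2,2,4⟩) = R̃(⟨2,2,4⟩) = 2^{ω(1,1,2)} ≥ 2^{ω+1}`,
  while `F(⟨2,2,4⟩) = F(⟨2,2,2⟩) F(⟨1,1,2⟩)` with `F(⟨2,2,2⟩) ≤ R̃(⟨2,2,2⟩) = 2^ω` and
  `F(⟨1,1,2⟩) ≤ R(⟨1,1,2⟩) ≤ 2`, forcing both equalities.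
-/

-- The prover namespace `Summit.<Summit>.<Problem>.Theorems` repeats `MatrixMultiplication` (summit =
-- sub-problem), which `linter.dupNamespace` would flag.
set_option linter.dupNamespace false

namespace Summit.MatrixMultiplication.MatrixMultiplication.Theorems

open Filter Asymptotics
open Literature.Computability.AlgebraicComplexity
open Literature.Barriers.MatrixMultiplication

/-- Dictionary: the rank-form `O`-bound for `⟨n,n,n^k⟩` is membership of `β` in the admissible
exponents of `(1,1,k)`-rectangular matrix multiplication (`⌈n^1⌉ = n`, `⌈n^k⌉ = n^k`). -/
theorem eprFaces_isBigO_iff_mem_rectAdmissibleExponents (k : ℕ) (β : ℝ) :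
    ((fun n : ℕ => (tensorRank (matMulTensor ℂ n n (n ^ k)) : ℝ)) =O[Filter.atTop]
        fun n : ℕ => (n : ℝ) ^ β) ↔ β ∈ rectAdmissibleExponents ℂ 1 1 (k : ℝ) := by
  have h : (fun n : ℕ =>
      (tensorRank (matMulTensor ℂ (rectDim n 1) (rectDim n 1) (rectDim n (k : ℝ))) : ℝ)) =
      fun n : ℕ => (tensorRank (matMulTensor ℂ n n (n ^ k)) : ℝ) := by
    funext n
    rw [tensorRank_matMulTensor_congr ℂ (rectDim_one n) (rectDim_one n) (rectDim_natCast n k)]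
  show _ ↔ ((fun n : ℕ =>
      (tensorRank (matMulTensor ℂ (rectDim n 1) (rectDim n 1) (rectDim n (k : ℝ))) : ℝ)) =O[atTop]
        fun n : ℕ => (n : ℝ) ^ β)
  rw [h]

/-- Dictionary: B in rank form is `∀ k ≥ 1, ω + (k − 1) ≤ ω(1,1,k)` (`csInf_le` / `le_csInf`, the
admissible exponents of `(1,1,k)` being nonempty and bounded below). -/
theorem eprFaces_faceMaximiser_iff_omegaRect :
    (∀ k : ℕ, 1 ≤ k → ∀ β : ℝ, ((fun n : ℕ => (tensorRank (matMulTensor ℂ n n (n ^ k)) : ℝ))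
      =O[Filter.atTop] fun n : ℕ => (n : ℝ) ^ β) → omega ℂ + ((k : ℝ) - 1) ≤ β) ↔
    ∀ k : ℕ, 1 ≤ k → omega ℂ + ((k : ℝ) - 1) ≤ omegaRect ℂ 1 1 (k : ℝ) := by
  constructor
  · intro h k hk
    unfold omegaRect
    refine le_csInf (rectAdmissibleExponents_nonempty ℂ 1 1 (k : ℝ)) fun β hβ => ?_
    exact h k hk β ((eprFaces_isBigO_iff_mem_rectAdmissibleExponents k β).2 hβ)
  · intro h k hk β hβ
    refine (h k hk).trans ?_
    unfold omegaRect
    exact csInf_le (rectAdmissibleExponents_one_one_bddBelow ℂ (k : ℝ))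
      ((eprFaces_isBigO_iff_mem_rectAdmissibleExponents k β).1 hβ)

/-- Multiplicativity along the third format: for a universal spectral point `F` over `ℂ`,
`F(⟨2,2,2^(j+1)⟩) = F(⟨2,2,2⟩) · F(⟨1,1,2⟩)^j` (`⟨2,2,2^(j+2)⟩ ≅ ⟨2,2,2^(j+1)⟩ ⊗ ⟨1,1,2⟩`). -/
theorem eprFaces_map_matMulTensor_two_two_pow_succ {F : SpectralMap ℂ}
    (hF : IsUniversalSpectralPoint ℂ F) (j : ℕ) :
    F (matMulTensor ℂ 2 2 (2 ^ (j + 1))) =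
      F (matMulTensor ℂ 2 2 2) * F (matMulTensor ℂ 1 1 2) ^ j := by
  have hA := hF.isAdequate (@strassen_duality_asymptoticRank_holds ℂ _)
  induction j with
  | zero =>
    rw [SpectralMap.map_matMulTensor_congr F rfl rfl (show 2 ^ (0 + 1) = 2 from rfl), pow_zero,
      mul_one]
  | succ j ih =>
    rw [SpectralMap.map_matMulTensor_congr F (mul_one 2).symm (mul_one 2).symm (pow_succ 2 (j + 1)),
      hA.mamu 2 1 2 1 (2 ^ (j + 1)) 2 (by norm_num) le_rfl (by norm_num) le_rfl Nat.one_le_two_pow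
        (by norm_num), ih, pow_succ, mul_assoc]

/-- **Support `SpectralFaceForm` of route `EPRFaces`** (item `stmt-MatrixMultiplication-10900`): the
chart form of B — some universal spectral point `F` with `F(⟨2,2,2⟩) = 2^ω` lies on the EPR face
`F(⟨1,1,2⟩) = 2` — is equivalent to B in rank form. -/
theorem spectralFaceForm_proof :
    Summit.MatrixMultiplication.MatrixMultiplication.Theses.EPRFaces.SpectralFaceForm := by
  unfold Summit.MatrixMultiplication.MatrixMultiplication.Theses.EPRFaces.SpectralFaceForm
  refine Iff.trans ?_ eprFaces_faceMaximiser_iff_omegaRect.symm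
  have hd : strassen_duality_asymptoticRank ℂ := @strassen_duality_asymptoticRank_holds ℂ _
  constructor
  · rintro ⟨F, hF, h222, h112⟩ k hk
    obtain ⟨j, rfl⟩ : ∃ j, k = j + 1 := ⟨k - 1, by omega⟩
    -- the value `F(⟨2,2,2^(j+1)⟩) = 2^ω · 2^j`
    have hval : F (matMulTensor ℂ 2 2 (2 ^ (j + 1))) = (2 : ℝ) ^ omega ℂ * 2 ^ j := by
      rw [eprFaces_map_matMulTensor_two_two_pow_succ hF, h222, h112]
    -- duality: `F ≤ R̃(⟨2,2,2^(j+1)⟩) = 2^{ω(1,1,j+1)}`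
    have hle : F (matMulTensor ℂ 2 2 (2 ^ (j + 1))) ≤
        (2 : ℝ) ^ omegaRect ℂ 1 1 ((j + 1 : ℕ) : ℝ) := by
      rw [SpectralMap.map_matMulTensor_congr F (pow_one 2).symm (pow_one 2).symm rfl]
      have h1 := (hd (matMulTensor ℂ (2 ^ 1) (2 ^ 1) (2 ^ (j + 1)))).1 F hF
      rw [asymptoticRank_matMulTensor_rect ℂ (q := 2) le_rfl 1 1 (j + 1)] at h1
      simpa only [Nat.cast_one, Nat.cast_ofNat] using h1
    have key : (2 : ℝ) ^ (omega ℂ + j) ≤ (2 : ℝ) ^ omegaRect ℂ 1 1 ((j + 1 : ℕ) : ℝ) := by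
      calc (2 : ℝ) ^ (omega ℂ + j) = (2 : ℝ) ^ omega ℂ * 2 ^ j := by
            rw [Real.rpow_add two_pos, Real.rpow_natCast]
        _ = F (matMulTensor ℂ 2 2 (2 ^ (j + 1))) := hval.symm
        _ ≤ _ := hle
    have key' := (Real.rpow_le_rpow_left_iff (one_lt_two : (1 : ℝ) < 2)).1 key
    push_cast at key' ⊢
    linarith
  · intro hB
    obtain ⟨F, hF, hFeq⟩ := (hd (matMulTensor ℂ (2 ^ 1) (2 ^ 1) (2 ^ 2))).2
    have hA := hF.isAdequate hd
    refine ⟨F, hF, ?_⟩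
    -- `F(⟨2,2,4⟩) = F(⟨2,2,2⟩) F(⟨1,1,2⟩)`
    have hprod : F (matMulTensor ℂ (2 ^ 1) (2 ^ 1) (2 ^ 2)) =
        F (matMulTensor ℂ 2 2 2) * F (matMulTensor ℂ 1 1 2) := by
      rw [SpectralMap.map_matMulTensor_congr F (show 2 ^ 1 = 2 * 1 from rfl)
        (show 2 ^ 1 = 2 * 1 from rfl) (show 2 ^ 2 = 2 * 2 from rfl)]
      exact hA.mamu 2 1 2 1 2 2 (by norm_num) le_rfl (by norm_num) le_rfl (by norm_num) (by norm_num)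
    -- lower bound from B at `k = 2` and the maximiser: `2^{ω+1} ≤ 2^{ω(1,1,2)} = R̃ = F`
    have hlow : (2 : ℝ) ^ (omega ℂ + 1) ≤ F (matMulTensor ℂ 2 2 2) * F (matMulTensor ℂ 1 1 2) := by
      have hω := hB 2 (by norm_num)
      rw [← hprod, hFeq, asymptoticRank_matMulTensor_rect ℂ (q := 2) le_rfl 1 1 2]
      push_cast at hω ⊢
      exact Real.rpow_le_rpow_of_exponent_le one_le_two (by linarith)
    -- upper bounds: `F(⟨2,2,2⟩) ≤ R̃(⟨2,2,2⟩) = 2^ω`, `F(⟨1,1,2⟩) ≤ R(⟨1,1,2⟩) ≤ 2`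
    have h222le : F (matMulTensor ℂ 2 2 2) ≤ (2 : ℝ) ^ omega ℂ := by
      have h := (hd (matMulTensor ℂ 2 2 2)).1 F hF
      rw [asymptoticRank_matMulTensor ℂ 2 (by norm_num)] at h
      exact_mod_cast h
    have h112le : F (matMulTensor ℂ 1 1 2) ≤ 2 := by
      calc F (matMulTensor ℂ 1 1 2) ≤ tensorRank (matMulTensor ℂ 1 1 2) := hF.le_tensorRank _
        _ ≤ ((1 * 1 * 2 : ℕ) : ℝ) := by exact_mod_cast tensorRank_matMulTensor_le ℂ 1 1 2
        _ = 2 := by norm_num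
    have h0a : 0 ≤ F (matMulTensor ℂ 2 2 2) := hF.nonneg _
    have h0b : 0 ≤ F (matMulTensor ℂ 1 1 2) := hF.nonneg _
    have hpos : 0 < (2 : ℝ) ^ omega ℂ := Real.rpow_pos_of_pos two_pos _
    rw [Real.rpow_add two_pos, Real.rpow_one] at hlow
    have ha : F (matMulTensor ℂ 2 2 2) = (2 : ℝ) ^ omega ℂ := by
      refine le_antisymm h222le ?_
      nlinarith [mul_le_mul_of_nonneg_left h112le h0a]
    refine ⟨ha, le_antisymm h112le ?_⟩
    rw [ha] at hlow
    exact le_of_mul_le_mul_left hlow hpos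

end Summit.MatrixMultiplication.MatrixMultiplication.Theorems
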